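import Literature.AnabelianGeometry.SemiGraphs.TemperedReconstructionCor39AsymmetricLocallyFinite
import Literature.AnabelianGeometry.SemiGraphs.TemperedThm37iiiIffNoAnchorFree
import Literature.AnabelianGeometry.SemiGraphs.MetabelianLeafStarCor39
import Literature.AnabelianGeometry.SemiGraphs.TemperedThm37iiiIffivExoticProcyclic
import HarnessLib

/-!
# [SemiAnbd] Corollary 3.9, up to twist — the ASYMMETRIC cell on the class «TOP-CYCLIC» (any underlying
# graph), and the two Thm-3.7-(iii)-FREE quadrants at the RAYLESS STAR `𝒢⋆(p)` (proof-only)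

Mochizuki, *Semi-graphs of anabelioids*, Publ. RIMS **42** (2006), §3, Corollary 3.9 and its proof,
manuscript pp. 42–43 [cite: MochizukiSemiAnbd2006, Cor 3.9 pp.42-43]; Theorem 3.7 (iii)/(iv) pp. 40–41.

PROOF-ONLY file (abc-iut cell, layer L3, seat abc-iut-L3-t10 gen 12 — filed by gen 13, row «COR39-UPTOTWIST@TOP-CYCLIC·(iii)-FREE-SIDE»;
0 definitions, no named fact; LF-SGA cells F-1710 / F-2771).  This lineage's asymmetric cell of Cor. 3.9 up to
twist (`TemperedReconstructionCor39AsymmetricLocallyFinite.lean`, p493838) reads: clause (a) needs Thm. 3.7 (iii)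
(`CompactInVerticialAt`) at the SOURCE only, plus the two halves of Thm. 3.7 (iv) at the target —
(hvm) «verticial ⇒ maximal compact», (hei) «a nontrivial edge-like subgroup of a closed edge is the intersection of
two distinct maximal compact subgroups»; clause (b) needs (iii) at the TARGET only, plus (hvm)/(hei) at the source.
There the halves were supplied by LOCAL FINITENESS (abc-iut-w6-d062).  abc-iut-w6-d064 proved both halves on the
class of record «TOP-CYCLIC» — every countable graph of anabelioids satisfying the hypotheses of Thm. 3.7 ALL of
whose edge groups are topologically cyclic, with NO condition on the underlying graph (infinite valence,
infinitely-branching cores, rayless stars allowed): `isMaximalCompactSubgroup_of_mem_verticialSubgroups_of_topCyclic`,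
`exists_maximalCompact_inf_eq_of_mem_edgeLikeSubgroups_of_topCyclic` (`TemperedAnchoredCompactOfTopCyclic.lean`,
p496768).  Hence, BY NAME:

* `cor39a_upToTwistAt_of_topCyclic_target` — **(a) at every pair `(G, H)` with (iii) at `G` and `H` top-cyclic**;
  `cor39b_upToTwist_baseAt_of_topCyclic_source` — **(b) at every pair with `G` top-cyclic and (iii) at `H`**
  (existence of the locally open `F` inducing `φ` up to twist, `F.base` unique); the `InducesUpToTwist` currencies;
  the finite-partner specialisations; the joins «locally finite ∨ top-cyclic» with p493838;
* ★ `cor39UpToTwistAt_asymmetric_of_topCyclic` — at a pair of top-cyclic Cor-3.9 graphs: (iii) at `𝒢` ⇒ (a),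
  (iii) at `ℋ` ⇒ (b); and its ANCHOR-FREE currency (abc-iut-w6-d064's exact failure locus p497325: on the class,
  (iii) at `𝒢` ⟺ `π₁^temp(𝒢)` has no nontrivial anchor-free compact subgroup) and its Thm-3.7-(iv) currency
  (abc-iut-L3-t5's `compactInVerticialAt_of_maximalCompactIffVerticialAt_of_topCyclic`, p499807: on the class,
  (iv) at `𝒢` ⇒ (iii) at `𝒢`) — `cor39UpToTwistAt_asymmetric_of_topCyclic_of_maximalCompactIffVerticialAt`;
* ★ the instances at abc-iut-L3-t8's RAYLESS STAR `𝒢⋆(p)` (`metabelianLeafStar p`: edge groups `ℤ_p`, NOT locally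
  finite, and Thm. 3.7 (iii) sentence 1 FAILS there, `metabelianLeafStar_not_compactInVerticialAt` p489415):
  `metabelianLeafStar_cor39a_upToTwistAt_target` — (a) at EVERY pair `(𝒦, 𝒢⋆(p))` with (iii) at `𝒦` (finite `𝒦`:
  hypothesis-free), and `metabelianLeafStar_cor39b_upToTwist_baseAt_source` — (b) at EVERY pair `(𝒢⋆(p), ℋ)`
  with (iii) at `ℋ` (finite `ℋ`: hypothesis-free).  These are the two (iii)-FREE quadrants of the cell's row
  «COR39-UPTOTWIST@RAYLESS-STAR»; the two (iii)-SIDE quadrants ((a) with source `𝒢⋆(p)`, (b) with target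
  `𝒢⋆(p)`) are NOT touched: the closers need (iii) exactly on that side, and it fails at the star
  (`metabelianLeafStar_cor39UpToTwist_iiiFree_quadrants` records the conjunction).

HONEST FRAMING: OUR rendering at OUR typed objects; outside the [IUTchIII] Cor. 3.12 cone (every print consumer
of Cor. 3.9 has a finite dual graph, where both clauses are kernel theorems of the finite files); a class-level
widening of the per-pair typing, not a claim about print; nothing asserts abc proved or refuted; typed ≠ proved.
-/

open CategoryTheory Topology

namespace Literature.AnabelianGeometry.SemiGraphs

namespace ProfiniteSemiGraph

universe u

variable {𝒢 ℋ : ProfiniteSemiGraph.{u}}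

/-! ### The two halves of Thm. 3.7 (iv) on «TOP-CYCLIC», in the binder shape of the Cor-3.9 closers -/

/-- (hvm) «verticial ⇒ maximal compact» at every chart of a Cor-3.9 graph with topologically cyclic edge groups,
any underlying graph (abc-iut-w6-d064's `isMaximalCompactSubgroup_of_mem_verticialSubgroups_of_topCyclic`, re-exported
in the binder shape of the `_targetHalves` / `_sourceHalves` closers). [cite: MochizukiSemiAnbd2006, Thm 3.7(iv) p.41] -/
theorem hvm_of_topCyclic (h : Cor39Hypotheses 𝒢)
    (hcyc : ∀ e : 𝒢.graph.Edge, ∃ t₀ : 𝒢.Ge e, (Subgroup.zpowers t₀).topologicalClosure = ⊤)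
    (c : TemperedPiChart 𝒢) :
    ∀ (v : 𝒢.graph.Vertex) (K : Subgroup c.G), K ∈ verticialSubgroups c v → IsMaximalCompactSubgroup K :=
  fun _ _ hK => 𝒢.isMaximalCompactSubgroup_of_mem_verticialSubgroups_of_topCyclic h.thm37Hypotheses hcyc c hK

/-- (hei) «a nontrivial edge-like subgroup of a closed edge is the intersection of two distinct maximal compact
subgroups» at every chart of a Cor-3.9 graph with topologically cyclic edge groups, any underlying graph
(abc-iut-w6-d064's `exists_maximalCompact_inf_eq_of_mem_edgeLikeSubgroups_of_topCyclic`).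
[cite: MochizukiSemiAnbd2006, Thm 3.7(iv) p.41] -/
theorem hei_of_topCyclic (h : Cor39Hypotheses 𝒢)
    (hcyc : ∀ e : 𝒢.graph.Edge, ∃ t₀ : 𝒢.Ge e, (Subgroup.zpowers t₀).topologicalClosure = ⊤)
    (c : TemperedPiChart 𝒢) :
    ∀ (e : 𝒢.graph.Edge) (L : Subgroup c.G), 𝒢.graph.IsClosedEdge e → L ∈ edgeLikeSubgroups c e →
      L ≠ ⊥ → ∃ K₁ K₂ : Subgroup c.G, IsMaximalCompactSubgroup K₁ ∧ IsMaximalCompactSubgroup K₂ ∧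
        K₁ ≠ K₂ ∧ L = K₁ ⊓ K₂ :=
  fun _ _ he hL hLne =>
    𝒢.exists_maximalCompact_inf_eq_of_mem_edgeLikeSubgroups_of_topCyclic h.thm37Hypotheses hcyc c he hL hLne

/-! ### Cor. 3.9 (a), up to twist, at every TOP-CYCLIC target -/

/-- **[SemiAnbd] Cor. 3.9 (a), up to twist, at EVERY target `H` whose edge groups are topologically cyclic (ANY
underlying graph) and every source `G` satisfying Thm. 3.7 (iii)**: a homomorphism induced up to twist by a
locally open `F : G → H` is compatibly quasi-geometric.  No local finiteness, no Thm. 3.7 (iii)/(iv) at `H`.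
[cite: MochizukiSemiAnbd2006, Cor 3.9 p.42] -/
theorem cor39a_upToTwistAt_of_topCyclic_target (h𝒢iii : CompactInVerticialAt 𝒢)
    (hcycℋ : ∀ e : ℋ.graph.Edge, ∃ t₀ : ℋ.Ge e, (Subgroup.zpowers t₀).topologicalClosure = ⊤)
    (h𝒢 : Cor39Hypotheses 𝒢) (hℋ : Cor39Hypotheses ℋ) (c𝒢 : TemperedPiChart 𝒢) (cℋ : TemperedPiChart ℋ)
    (F : Hom 𝒢 ℋ) (hF : F.IsLocallyOpen) (φ : c𝒢.G →ₜ* cℋ.G)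
    (hind : ∃ θ : F.ConjugatorFamily, Nonempty (F.chartPullbackWith θ c𝒢 cℋ ≅ BTemp.res φ)) :
    IsCompatiblyQuasiGeometric φ :=
  cor39a_upToTwistAt_of_targetHalves h𝒢iii h𝒢 hℋ c𝒢 cℋ (hvm_of_topCyclic hℋ hcycℋ cℋ)
    (hei_of_topCyclic hℋ hcycℋ cℋ) F hF φ hind

/-- The same in the named currency `Hom.InducesUpToTwist`. [cite: MochizukiSemiAnbd2006, Cor 3.9 p.42] -/
theorem cor39a_compatUpToTwistAt_of_topCyclic_target (h𝒢iii : CompactInVerticialAt 𝒢)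
    (hcycℋ : ∀ e : ℋ.graph.Edge, ∃ t₀ : ℋ.Ge e, (Subgroup.zpowers t₀).topologicalClosure = ⊤)
    (h𝒢 : Cor39Hypotheses 𝒢) (hℋ : Cor39Hypotheses ℋ) (c𝒢 : TemperedPiChart 𝒢) (cℋ : TemperedPiChart ℋ)
    (F : Hom 𝒢 ℋ) (hF : F.IsLocallyOpen) (φ : c𝒢.G →ₜ* cℋ.G) (hind : F.InducesUpToTwist c𝒢 cℋ φ) :
    IsCompatiblyQuasiGeometric φ :=
  cor39a_upToTwistAt_of_topCyclic_target h𝒢iii hcycℋ h𝒢 hℋ c𝒢 cℋ F hF φ hind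

/-- **Cor. 3.9 (a) with a FINITE source and a top-cyclic target of ANY shape** (Thm. 3.7 (iii) at the source by
abc-iut-L3-t8's `compactInVerticialAt_of_finiteGraph`): hypothesis-free beyond the hypotheses of Cor. 3.9 — the shape
«a finite graph of anabelioids mapping into an infinite-valence one with procyclic edge groups».
[cite: MochizukiSemiAnbd2006, Cor 3.9 p.42] -/
theorem cor39a_upToTwistAt_of_finite_of_topCyclic [Finite 𝒢.graph.Vertex] [Finite 𝒢.graph.Edge]
    (hcycℋ : ∀ e : ℋ.graph.Edge, ∃ t₀ : ℋ.Ge e, (Subgroup.zpowers t₀).topologicalClosure = ⊤)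
    (h𝒢 : Cor39Hypotheses 𝒢) (hℋ : Cor39Hypotheses ℋ) (c𝒢 : TemperedPiChart 𝒢) (cℋ : TemperedPiChart ℋ)
    (F : Hom 𝒢 ℋ) (hF : F.IsLocallyOpen) (φ : c𝒢.G →ₜ* cℋ.G)
    (hind : ∃ θ : F.ConjugatorFamily, Nonempty (F.chartPullbackWith θ c𝒢 cℋ ≅ BTemp.res φ)) :
    IsCompatiblyQuasiGeometric φ :=
  cor39a_upToTwistAt_of_topCyclic_target compactInVerticialAt_of_finiteGraph hcycℋ h𝒢 hℋ c𝒢 cℋ F hF φ hind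

/-- **Cor. 3.9 (a), the (iii)-free side as the JOIN of the two classes of record**: (iii) at the source and a
target that is LOCALLY FINITE (p493838) OR TOP-CYCLIC (this file). [cite: MochizukiSemiAnbd2006, Cor 3.9 p.42] -/
theorem cor39a_upToTwistAt_of_isLocallyFinite_or_topCyclic_target (h𝒢iii : CompactInVerticialAt 𝒢)
    (hℋ' : ℋ.graph.IsLocallyFinite ∨
      ∀ e : ℋ.graph.Edge, ∃ t₀ : ℋ.Ge e, (Subgroup.zpowers t₀).topologicalClosure = ⊤)
    (h𝒢 : Cor39Hypotheses 𝒢) (hℋ : Cor39Hypotheses ℋ) (c𝒢 : TemperedPiChart 𝒢) (cℋ : TemperedPiChart ℋ)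
    (F : Hom 𝒢 ℋ) (hF : F.IsLocallyOpen) (φ : c𝒢.G →ₜ* cℋ.G)
    (hind : ∃ θ : F.ConjugatorFamily, Nonempty (F.chartPullbackWith θ c𝒢 cℋ ≅ BTemp.res φ)) :
    IsCompatiblyQuasiGeometric φ := by
  rcases hℋ' with hlf | hcyc
  · exact cor39a_upToTwistAt_of_isLocallyFinite_target h𝒢iii hlf h𝒢 hℋ c𝒢 cℋ F hF φ hind
  · exact cor39a_upToTwistAt_of_topCyclic_target h𝒢iii hcyc h𝒢 hℋ c𝒢 cℋ F hF φ hind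

/-! ### Cor. 3.9 (b), up to twist, at every TOP-CYCLIC source -/

/-- **[SemiAnbd] Cor. 3.9 (b), up to twist, at EVERY source `G` whose edge groups are topologically cyclic (ANY
underlying graph) and every target `H` satisfying Thm. 3.7 (iii)**: every compatibly quasi-geometric
`φ : π₁^temp(G) → π₁^temp(H)` is induced up to twist by a locally open `F : G → H`, unique on underlying
semi-graphs.  No local finiteness, no Thm. 3.7 (iii)/(iv) at `G`. [cite: MochizukiSemiAnbd2006, Cor 3.9 pp.42-43] -/
theorem cor39b_upToTwist_baseAt_of_topCyclic_source
    (hcyc𝒢 : ∀ e : 𝒢.graph.Edge, ∃ t₀ : 𝒢.Ge e, (Subgroup.zpowers t₀).topologicalClosure = ⊤)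
    (hℋiii : CompactInVerticialAt ℋ) (h𝒢 : Cor39Hypotheses 𝒢) (hℋ : Cor39Hypotheses ℋ)
    (c𝒢 : TemperedPiChart 𝒢) (cℋ : TemperedPiChart ℋ) (φ : c𝒢.G →ₜ* cℋ.G)
    (hφ : IsCompatiblyQuasiGeometric φ) :
    ∃ F : Hom 𝒢 ℋ, F.IsLocallyOpen ∧
      (∃ θ : F.ConjugatorFamily, Nonempty (F.chartPullbackWith θ c𝒢 cℋ ≅ BTemp.res φ)) ∧
      ∀ F' : Hom 𝒢 ℋ, F'.IsLocallyOpen →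
        (∃ θ' : F'.ConjugatorFamily, Nonempty (F'.chartPullbackWith θ' c𝒢 cℋ ≅ BTemp.res φ)) →
          F'.base = F.base :=
  cor39b_upToTwist_baseAt_of_sourceHalves hℋiii h𝒢 hℋ c𝒢 cℋ (hvm_of_topCyclic h𝒢 hcyc𝒢 c𝒢)
    (hei_of_topCyclic h𝒢 hcyc𝒢 c𝒢) φ hφ

/-- The same in the named currency `Hom.InducesUpToTwist`. [cite: MochizukiSemiAnbd2006, Cor 3.9 pp.42-43] -/
theorem cor39b_compatUpToTwistAt_of_topCyclic_source
    (hcyc𝒢 : ∀ e : 𝒢.graph.Edge, ∃ t₀ : 𝒢.Ge e, (Subgroup.zpowers t₀).topologicalClosure = ⊤)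
    (hℋiii : CompactInVerticialAt ℋ) (h𝒢 : Cor39Hypotheses 𝒢) (hℋ : Cor39Hypotheses ℋ)
    (c𝒢 : TemperedPiChart 𝒢) (cℋ : TemperedPiChart ℋ) (φ : c𝒢.G →ₜ* cℋ.G)
    (hφ : IsCompatiblyQuasiGeometric φ) :
    ∃ F : Hom 𝒢 ℋ, F.IsLocallyOpen ∧ F.InducesUpToTwist c𝒢 cℋ φ ∧
      ∀ F' : Hom 𝒢 ℋ, F'.IsLocallyOpen → F'.InducesUpToTwist c𝒢 cℋ φ → F'.base = F.base :=
  cor39b_upToTwist_baseAt_of_topCyclic_source hcyc𝒢 hℋiii h𝒢 hℋ c𝒢 cℋ φ hφ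

/-- **Cor. 3.9 (b) with a top-cyclic source of ANY shape and a FINITE target** (Thm. 3.7 (iii) at the target by
`compactInVerticialAt_of_finiteGraph`) — hypothesis-free beyond the hypotheses of Cor. 3.9: the shape «an
infinite-valence graph of anabelioids with procyclic edge groups mapping to a finite one».
[cite: MochizukiSemiAnbd2006, Cor 3.9 pp.42-43] -/
theorem cor39b_upToTwist_baseAt_of_topCyclic_of_finite
    (hcyc𝒢 : ∀ e : 𝒢.graph.Edge, ∃ t₀ : 𝒢.Ge e, (Subgroup.zpowers t₀).topologicalClosure = ⊤)
    [Finite ℋ.graph.Vertex] [Finite ℋ.graph.Edge] (h𝒢 : Cor39Hypotheses 𝒢) (hℋ : Cor39Hypotheses ℋ)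
    (c𝒢 : TemperedPiChart 𝒢) (cℋ : TemperedPiChart ℋ) (φ : c𝒢.G →ₜ* cℋ.G)
    (hφ : IsCompatiblyQuasiGeometric φ) :
    ∃ F : Hom 𝒢 ℋ, F.IsLocallyOpen ∧
      (∃ θ : F.ConjugatorFamily, Nonempty (F.chartPullbackWith θ c𝒢 cℋ ≅ BTemp.res φ)) ∧
      ∀ F' : Hom 𝒢 ℋ, F'.IsLocallyOpen →
        (∃ θ' : F'.ConjugatorFamily, Nonempty (F'.chartPullbackWith θ' c𝒢 cℋ ≅ BTemp.res φ)) →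
          F'.base = F.base :=
  cor39b_upToTwist_baseAt_of_topCyclic_source hcyc𝒢 compactInVerticialAt_of_finiteGraph h𝒢 hℋ c𝒢 cℋ φ hφ

/-- **Cor. 3.9 (b), the (iii)-free side as the JOIN of the two classes of record**: (iii) at the target and a
source that is LOCALLY FINITE (p493595) OR TOP-CYCLIC (this file). [cite: MochizukiSemiAnbd2006, Cor 3.9 pp.42-43] -/
theorem cor39b_upToTwist_baseAt_of_isLocallyFinite_or_topCyclic_source
    (h𝒢' : 𝒢.graph.IsLocallyFinite ∨
      ∀ e : 𝒢.graph.Edge, ∃ t₀ : 𝒢.Ge e, (Subgroup.zpowers t₀).topologicalClosure = ⊤)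
    (hℋiii : CompactInVerticialAt ℋ) (h𝒢 : Cor39Hypotheses 𝒢) (hℋ : Cor39Hypotheses ℋ)
    (c𝒢 : TemperedPiChart 𝒢) (cℋ : TemperedPiChart ℋ) (φ : c𝒢.G →ₜ* cℋ.G)
    (hφ : IsCompatiblyQuasiGeometric φ) :
    ∃ F : Hom 𝒢 ℋ, F.IsLocallyOpen ∧
      (∃ θ : F.ConjugatorFamily, Nonempty (F.chartPullbackWith θ c𝒢 cℋ ≅ BTemp.res φ)) ∧
      ∀ F' : Hom 𝒢 ℋ, F'.IsLocallyOpen →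
        (∃ θ' : F'.ConjugatorFamily, Nonempty (F'.chartPullbackWith θ' c𝒢 cℋ ≅ BTemp.res φ)) →
          F'.base = F.base := by
  rcases h𝒢' with hlf | hcyc
  · exact cor39b_upToTwist_baseAt_of_isLocallyFinite_source hlf hℋiii h𝒢 hℋ c𝒢 cℋ φ hφ
  · exact cor39b_upToTwist_baseAt_of_topCyclic_source hcyc hℋiii h𝒢 hℋ c𝒢 cℋ φ hφ

/-! ### The asymmetric TOP-CYCLIC cell of Cor. 3.9 (up to twist) -/

/-- **[SemiAnbd] Corollary 3.9, up to twist, at a pair of TOP-CYCLIC Cor-3.9 graphs (any underlying graphs) —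
the ASYMMETRIC cell**: Thm. 3.7 (iii) at `𝒢` gives clause (a); Thm. 3.7 (iii) at `ℋ` gives clause (b) with full
uniqueness of `F.base`.  (Locally finite analogue: `cor39UpToTwistAt_asymmetric_of_isLocallyFinite`, p493838.)
[cite: MochizukiSemiAnbd2006, Cor 3.9 pp.42-43] -/
theorem cor39UpToTwistAt_asymmetric_of_topCyclic
    (hcyc𝒢 : ∀ e : 𝒢.graph.Edge, ∃ t₀ : 𝒢.Ge e, (Subgroup.zpowers t₀).topologicalClosure = ⊤)
    (hcycℋ : ∀ e : ℋ.graph.Edge, ∃ t₀ : ℋ.Ge e, (Subgroup.zpowers t₀).topologicalClosure = ⊤)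
    (h𝒢 : Cor39Hypotheses 𝒢) (hℋ : Cor39Hypotheses ℋ) (c𝒢 : TemperedPiChart 𝒢) (cℋ : TemperedPiChart ℋ) :
    (CompactInVerticialAt 𝒢 →
      ∀ (F : Hom 𝒢 ℋ), F.IsLocallyOpen → ∀ φ : c𝒢.G →ₜ* cℋ.G,
        (∃ θ : F.ConjugatorFamily, Nonempty (F.chartPullbackWith θ c𝒢 cℋ ≅ BTemp.res φ)) →
          IsCompatiblyQuasiGeometric φ) ∧
    (CompactInVerticialAt ℋ →
      ∀ φ : c𝒢.G →ₜ* cℋ.G, IsCompatiblyQuasiGeometric φ →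
        ∃ F : Hom 𝒢 ℋ, F.IsLocallyOpen ∧
          (∃ θ : F.ConjugatorFamily, Nonempty (F.chartPullbackWith θ c𝒢 cℋ ≅ BTemp.res φ)) ∧
          ∀ F' : Hom 𝒢 ℋ, F'.IsLocallyOpen →
            (∃ θ' : F'.ConjugatorFamily, Nonempty (F'.chartPullbackWith θ' c𝒢 cℋ ≅ BTemp.res φ)) →
              F'.base = F.base) :=
  ⟨fun h𝒢iii F hF φ hind => cor39a_upToTwistAt_of_topCyclic_target h𝒢iii hcycℋ h𝒢 hℋ c𝒢 cℋ F hF φ hind,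
    fun hℋiii φ hφ => cor39b_upToTwist_baseAt_of_topCyclic_source hcyc𝒢 hℋiii h𝒢 hℋ c𝒢 cℋ φ hφ⟩

/-- **The same cell in ANCHOR-FREE currency** (abc-iut-w6-d064's exact failure locus on the class,
`compactInVerticialAt_iff_forall_anchorFree_eq_bot_of_topCyclic`, p497325): at a pair of top-cyclic Cor-3.9 graphs,
«`π₁^temp(𝒢)` has no nontrivial ANCHOR-FREE compact subgroup (one meeting every verticial subgroup trivially), at
every chart» gives (a), and the same at `ℋ` gives (b). [cite: MochizukiSemiAnbd2006, Cor 3.9 pp.42-43] -/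
theorem cor39UpToTwistAt_asymmetric_of_topCyclic_of_forall_anchorFree_eq_bot
    (hcyc𝒢 : ∀ e : 𝒢.graph.Edge, ∃ t₀ : 𝒢.Ge e, (Subgroup.zpowers t₀).topologicalClosure = ⊤)
    (hcycℋ : ∀ e : ℋ.graph.Edge, ∃ t₀ : ℋ.Ge e, (Subgroup.zpowers t₀).topologicalClosure = ⊤)
    (h𝒢 : Cor39Hypotheses 𝒢) (hℋ : Cor39Hypotheses ℋ) (c𝒢 : TemperedPiChart 𝒢) (cℋ : TemperedPiChart ℋ) :
    ((∀ (c : TemperedPiChart 𝒢) (K : Subgroup c.G), IsCompact (K : Set c.G) →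
        (∀ (v : 𝒢.graph.Vertex) (H : Subgroup c.G), H ∈ verticialSubgroups c v → K ⊓ H = ⊥) → K = ⊥) →
      ∀ (F : Hom 𝒢 ℋ), F.IsLocallyOpen → ∀ φ : c𝒢.G →ₜ* cℋ.G,
        (∃ θ : F.ConjugatorFamily, Nonempty (F.chartPullbackWith θ c𝒢 cℋ ≅ BTemp.res φ)) →
          IsCompatiblyQuasiGeometric φ) ∧
    ((∀ (c : TemperedPiChart ℋ) (K : Subgroup c.G), IsCompact (K : Set c.G) →
        (∀ (v : ℋ.graph.Vertex) (H : Subgroup c.G), H ∈ verticialSubgroups c v → K ⊓ H = ⊥) → K = ⊥) →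
      ∀ φ : c𝒢.G →ₜ* cℋ.G, IsCompatiblyQuasiGeometric φ →
        ∃ F : Hom 𝒢 ℋ, F.IsLocallyOpen ∧
          (∃ θ : F.ConjugatorFamily, Nonempty (F.chartPullbackWith θ c𝒢 cℋ ≅ BTemp.res φ)) ∧
          ∀ F' : Hom 𝒢 ℋ, F'.IsLocallyOpen →
            (∃ θ' : F'.ConjugatorFamily, Nonempty (F'.chartPullbackWith θ' c𝒢 cℋ ≅ BTemp.res φ)) →
              F'.base = F.base) := by
  obtain ⟨ha, hb⟩ := cor39UpToTwistAt_asymmetric_of_topCyclic hcyc𝒢 hcycℋ h𝒢 hℋ c𝒢 cℋ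
  exact ⟨fun hfree => ha ((𝒢.compactInVerticialAt_iff_forall_anchorFree_eq_bot_of_topCyclic hcyc𝒢).mpr
      fun _ => hfree),
    fun hfree => hb ((ℋ.compactInVerticialAt_iff_forall_anchorFree_eq_bot_of_topCyclic hcycℋ).mpr
      fun _ => hfree)⟩

/-- **The same cell in Thm-3.7-(iv) currency** (abc-iut-L3-t5's
`compactInVerticialAt_of_maximalCompactIffVerticialAt_of_topCyclic`, p499807: on the class «TOP-CYCLIC», Thm. 3.7 (iv)
at a graph implies Thm. 3.7 (iii) at it): at a pair of top-cyclic Cor-3.9 graphs (any underlying graphs),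
`MaximalCompactIffVerticialAt 𝒢` («maximal compact ⟺ verticial, and nontrivial intersections of two distinct maximal
compact subgroups = edge-like subgroups of closed edges», at every chart of `𝒢`) gives clause (a), and
`MaximalCompactIffVerticialAt ℋ` gives clause (b) with uniqueness of `F.base`.
[cite: MochizukiSemiAnbd2006, Cor 3.9 pp.42-43] -/
theorem cor39UpToTwistAt_asymmetric_of_topCyclic_of_maximalCompactIffVerticialAt
    (hcyc𝒢 : ∀ e : 𝒢.graph.Edge, ∃ t₀ : 𝒢.Ge e, (Subgroup.zpowers t₀).topologicalClosure = ⊤)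
    (hcycℋ : ∀ e : ℋ.graph.Edge, ∃ t₀ : ℋ.Ge e, (Subgroup.zpowers t₀).topologicalClosure = ⊤)
    (h𝒢 : Cor39Hypotheses 𝒢) (hℋ : Cor39Hypotheses ℋ) (c𝒢 : TemperedPiChart 𝒢) (cℋ : TemperedPiChart ℋ) :
    (MaximalCompactIffVerticialAt 𝒢 →
      ∀ (F : Hom 𝒢 ℋ), F.IsLocallyOpen → ∀ φ : c𝒢.G →ₜ* cℋ.G,
        (∃ θ : F.ConjugatorFamily, Nonempty (F.chartPullbackWith θ c𝒢 cℋ ≅ BTemp.res φ)) →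
          IsCompatiblyQuasiGeometric φ) ∧
    (MaximalCompactIffVerticialAt ℋ →
      ∀ φ : c𝒢.G →ₜ* cℋ.G, IsCompatiblyQuasiGeometric φ →
        ∃ F : Hom 𝒢 ℋ, F.IsLocallyOpen ∧
          (∃ θ : F.ConjugatorFamily, Nonempty (F.chartPullbackWith θ c𝒢 cℋ ≅ BTemp.res φ)) ∧
          ∀ F' : Hom 𝒢 ℋ, F'.IsLocallyOpen →
            (∃ θ' : F'.ConjugatorFamily, Nonempty (F'.chartPullbackWith θ' c𝒢 cℋ ≅ BTemp.res φ)) →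
              F'.base = F.base) := by
  obtain ⟨ha, hb⟩ := cor39UpToTwistAt_asymmetric_of_topCyclic hcyc𝒢 hcycℋ h𝒢 hℋ c𝒢 cℋ
  exact ⟨fun hIV => ha (𝒢.compactInVerticialAt_of_maximalCompactIffVerticialAt_of_topCyclic hcyc𝒢 hIV),
    fun hIV => hb (ℋ.compactInVerticialAt_of_maximalCompactIffVerticialAt_of_topCyclic hcycℋ hIV)⟩

end ProfiniteSemiGraph

/-! ### The two (iii)-FREE quadrants at the rayless star `𝒢⋆(p)` -/

namespace ProfiniteSemiGraph

open Multiplicative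

variable (p : ℕ) [hp : Fact p.Prime] {𝒦 : ProfiniteSemiGraph.{0}}

/-- The edge groups `ℤ_p` of the rayless star `𝒢⋆(p)` are topologically cyclic (generator `1`; `FreeProPRankTwoGluing.lean`'s
`FreeProPRankTwo.topologicalClosure_zpowers_ofAdd_one`) — `𝒢⋆(p)` is in the class «TOP-CYCLIC».
[cite: MochizukiSemiAnbd2006, Def 2.1 p.22] -/
theorem metabelianLeafStar_topCyclic :
    ∀ e : (metabelianLeafStar p).graph.Edge, ∃ t₀ : (metabelianLeafStar p).Ge e,
      (Subgroup.zpowers t₀).topologicalClosure = ⊤ :=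
  fun _ => ⟨ofAdd (1 : ℤ_[p]), FreeProPRankTwo.topologicalClosure_zpowers_ofAdd_one p⟩

/-- **Cor. 3.9 (a), up to twist, with TARGET the rayless star `𝒢⋆(p)`** and ANY source `𝒦` satisfying
Thm. 3.7 (iii), every pair of charts: a homomorphism induced up to twist by a locally open `F : 𝒦 → 𝒢⋆(p)` is
compatibly quasi-geometric — although `𝒢⋆(p)` is not locally finite and Thm. 3.7 (iii) FAILS at `𝒢⋆(p)`
(`metabelianLeafStar_not_compactInVerticialAt`). [cite: MochizukiSemiAnbd2006, Cor 3.9 p.42] -/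
theorem metabelianLeafStar_cor39a_upToTwistAt_target (h𝒦iii : CompactInVerticialAt 𝒦) (h𝒦 : Cor39Hypotheses 𝒦)
    (c𝒦 : TemperedPiChart 𝒦) (c : TemperedPiChart (metabelianLeafStar p))
    (F : Hom 𝒦 (metabelianLeafStar p)) (hF : F.IsLocallyOpen) (φ : c𝒦.G →ₜ* c.G)
    (hind : ∃ θ : F.ConjugatorFamily, Nonempty (F.chartPullbackWith θ c𝒦 c ≅ BTemp.res φ)) :
    IsCompatiblyQuasiGeometric φ :=
  cor39a_upToTwistAt_of_topCyclic_target h𝒦iii (metabelianLeafStar_topCyclic p) h𝒦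
    (metabelianLeafStar_cor39Hypotheses p) c𝒦 c F hF φ hind

/-- **Cor. 3.9 (a) at every pair `(𝒦, 𝒢⋆(p))` with `𝒦` FINITE** — hypothesis-free beyond the hypotheses of
Cor. 3.9 at `𝒦`. [cite: MochizukiSemiAnbd2006, Cor 3.9 p.42] -/
theorem metabelianLeafStar_cor39a_upToTwistAt_target_of_finite [Finite 𝒦.graph.Vertex] [Finite 𝒦.graph.Edge]
    (h𝒦 : Cor39Hypotheses 𝒦) (c𝒦 : TemperedPiChart 𝒦) (c : TemperedPiChart (metabelianLeafStar p))
    (F : Hom 𝒦 (metabelianLeafStar p)) (hF : F.IsLocallyOpen) (φ : c𝒦.G →ₜ* c.G)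
    (hind : ∃ θ : F.ConjugatorFamily, Nonempty (F.chartPullbackWith θ c𝒦 c ≅ BTemp.res φ)) :
    IsCompatiblyQuasiGeometric φ :=
  metabelianLeafStar_cor39a_upToTwistAt_target p compactInVerticialAt_of_finiteGraph h𝒦 c𝒦 c F hF φ hind

/-- **Cor. 3.9 (b), up to twist, with SOURCE the rayless star `𝒢⋆(p)`** and ANY target `ℋ` satisfying
Thm. 3.7 (iii), every pair of charts: every compatibly quasi-geometric `φ : π₁^temp(𝒢⋆(p)) → π₁^temp(ℋ)` is
induced up to twist by a locally open `F : 𝒢⋆(p) → ℋ`, unique on underlying semi-graphs — although `𝒢⋆(p)` is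
not locally finite and Thm. 3.7 (iii) FAILS at `𝒢⋆(p)`. [cite: MochizukiSemiAnbd2006, Cor 3.9 pp.42-43] -/
theorem metabelianLeafStar_cor39b_upToTwist_baseAt_source {ℋ : ProfiniteSemiGraph.{0}}
    (hℋiii : CompactInVerticialAt ℋ) (hℋ : Cor39Hypotheses ℋ) (c : TemperedPiChart (metabelianLeafStar p))
    (cℋ : TemperedPiChart ℋ) (φ : c.G →ₜ* cℋ.G) (hφ : IsCompatiblyQuasiGeometric φ) :
    ∃ F : Hom (metabelianLeafStar p) ℋ, F.IsLocallyOpen ∧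
      (∃ θ : F.ConjugatorFamily, Nonempty (F.chartPullbackWith θ c cℋ ≅ BTemp.res φ)) ∧
      ∀ F' : Hom (metabelianLeafStar p) ℋ, F'.IsLocallyOpen →
        (∃ θ' : F'.ConjugatorFamily, Nonempty (F'.chartPullbackWith θ' c cℋ ≅ BTemp.res φ)) →
          F'.base = F.base :=
  cor39b_upToTwist_baseAt_of_topCyclic_source (metabelianLeafStar_topCyclic p) hℋiii
    (metabelianLeafStar_cor39Hypotheses p) hℋ c cℋ φ hφ

/-- **Cor. 3.9 (b) at every pair `(𝒢⋆(p), ℋ)` with `ℋ` FINITE** — hypothesis-free beyond the hypotheses of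
Cor. 3.9 at `ℋ`: the shape «the rayless star mapping to a finite graph of anabelioids».
[cite: MochizukiSemiAnbd2006, Cor 3.9 pp.42-43] -/
theorem metabelianLeafStar_cor39b_upToTwist_baseAt_source_of_finite {ℋ : ProfiniteSemiGraph.{0}}
    [Finite ℋ.graph.Vertex] [Finite ℋ.graph.Edge] (hℋ : Cor39Hypotheses ℋ)
    (c : TemperedPiChart (metabelianLeafStar p)) (cℋ : TemperedPiChart ℋ) (φ : c.G →ₜ* cℋ.G)
    (hφ : IsCompatiblyQuasiGeometric φ) :
    ∃ F : Hom (metabelianLeafStar p) ℋ, F.IsLocallyOpen ∧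
      (∃ θ : F.ConjugatorFamily, Nonempty (F.chartPullbackWith θ c cℋ ≅ BTemp.res φ)) ∧
      ∀ F' : Hom (metabelianLeafStar p) ℋ, F'.IsLocallyOpen →
        (∃ θ' : F'.ConjugatorFamily, Nonempty (F'.chartPullbackWith θ' c cℋ ≅ BTemp.res φ)) →
          F'.base = F.base :=
  metabelianLeafStar_cor39b_upToTwist_baseAt_source p compactInVerticialAt_of_finiteGraph hℋ c cℋ φ hφ

/-- **The two Thm-3.7-(iii)-FREE quadrants of «Cor. 3.9 up to twist at the rayless star» HOLD, while the
(iii)-side producers of record are SILENT at `𝒢⋆(p)`**: for every Cor-3.9 partner satisfying Thm. 3.7 (iii),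
(a) holds with target `𝒢⋆(p)` and (b) holds with source `𝒢⋆(p)` (every pair of charts) — and `𝒢⋆(p)` itself
satisfies NEITHER Thm. 3.7 (iii) (`metabelianLeafStar_not_compactInVerticialAt`, abc-iut-L3-t8) NOR local finiteness,
so neither the locally finite cell (p493838/p493595) nor the (iii)-side closers apply to the remaining two quadrants
((a) with source `𝒢⋆(p)`, (b) with target `𝒢⋆(p)`), which this file does not decide.
[cite: MochizukiSemiAnbd2006, Cor 3.9 pp.42-43] -/
theorem metabelianLeafStar_cor39UpToTwist_iiiFree_quadrants :
    (∀ (𝒦 : ProfiniteSemiGraph.{0}), CompactInVerticialAt 𝒦 → Cor39Hypotheses 𝒦 →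
      ∀ (c𝒦 : TemperedPiChart 𝒦) (c : TemperedPiChart (metabelianLeafStar p))
        (F : Hom 𝒦 (metabelianLeafStar p)), F.IsLocallyOpen → ∀ φ : c𝒦.G →ₜ* c.G,
          (∃ θ : F.ConjugatorFamily, Nonempty (F.chartPullbackWith θ c𝒦 c ≅ BTemp.res φ)) →
            IsCompatiblyQuasiGeometric φ) ∧
    (∀ (ℋ : ProfiniteSemiGraph.{0}), CompactInVerticialAt ℋ → Cor39Hypotheses ℋ →
      ∀ (c : TemperedPiChart (metabelianLeafStar p)) (cℋ : TemperedPiChart ℋ) (φ : c.G →ₜ* cℋ.G),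
        IsCompatiblyQuasiGeometric φ →
          ∃ F : Hom (metabelianLeafStar p) ℋ, F.IsLocallyOpen ∧
            (∃ θ : F.ConjugatorFamily, Nonempty (F.chartPullbackWith θ c cℋ ≅ BTemp.res φ)) ∧
            ∀ F' : Hom (metabelianLeafStar p) ℋ, F'.IsLocallyOpen →
              (∃ θ' : F'.ConjugatorFamily, Nonempty (F'.chartPullbackWith θ' c cℋ ≅ BTemp.res φ)) →
                F'.base = F.base) ∧
    ¬ CompactInVerticialAt (metabelianLeafStar p) ∧ ¬ (metabelianLeafStar p).graph.IsLocallyFinite :=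
  ⟨fun _ h𝒦iii h𝒦 c𝒦 c F hF φ hind =>
      metabelianLeafStar_cor39a_upToTwistAt_target p h𝒦iii h𝒦 c𝒦 c F hF φ hind,
    fun _ hℋiii hℋ c cℋ φ hφ => metabelianLeafStar_cor39b_upToTwist_baseAt_source p hℋiii hℋ c cℋ φ hφ,
    metabelianLeafStar_not_compactInVerticialAt p,
    (metabelianLeafStar_isConnected_isCountable_hasVertex p).2.2.2.2⟩

/-- **The (iii)-free side of Cor. 3.9 is NOT confined to locally finite graphs**: there is a countable Cor-3.9
graph that is NOT locally finite and FAILS Thm. 3.7 (iii), at which nevertheless clause (b) up to twist holds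
towards every finite Cor-3.9 target and clause (a) up to twist holds from every finite Cor-3.9 source, at every
pair of charts (witness `𝒢⋆(2)`). [cite: MochizukiSemiAnbd2006, Cor 3.9 pp.42-43] -/
theorem exists_not_isLocallyFinite_not_compactInVerticialAt_cor39_iiiFree :
    ∃ 𝒢 : ProfiniteSemiGraph.{0}, Cor39Hypotheses 𝒢 ∧ ¬ 𝒢.graph.IsLocallyFinite ∧ ¬ CompactInVerticialAt 𝒢 ∧
      (∀ (ℋ : ProfiniteSemiGraph.{0}) [Finite ℋ.graph.Vertex] [Finite ℋ.graph.Edge], Cor39Hypotheses ℋ →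
        ∀ (c : TemperedPiChart 𝒢) (cℋ : TemperedPiChart ℋ) (φ : c.G →ₜ* cℋ.G),
          IsCompatiblyQuasiGeometric φ →
            ∃ F : Hom 𝒢 ℋ, F.IsLocallyOpen ∧
              ∃ θ : F.ConjugatorFamily, Nonempty (F.chartPullbackWith θ c cℋ ≅ BTemp.res φ)) ∧
      (∀ (𝒦 : ProfiniteSemiGraph.{0}) [Finite 𝒦.graph.Vertex] [Finite 𝒦.graph.Edge], Cor39Hypotheses 𝒦 →
        ∀ (c𝒦 : TemperedPiChart 𝒦) (c : TemperedPiChart 𝒢) (F : Hom 𝒦 𝒢), F.IsLocallyOpen →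
          ∀ φ : c𝒦.G →ₜ* c.G,
            (∃ θ : F.ConjugatorFamily, Nonempty (F.chartPullbackWith θ c𝒦 c ≅ BTemp.res φ)) →
              IsCompatiblyQuasiGeometric φ) := by
  haveI : Fact (Nat.Prime 2) := ⟨Nat.prime_two⟩
  refine ⟨metabelianLeafStar 2, metabelianLeafStar_cor39Hypotheses 2,
    (metabelianLeafStar_isConnected_isCountable_hasVertex 2).2.2.2.2, metabelianLeafStar_not_compactInVerticialAt 2,
    fun ℋ _ _ hℋ c cℋ φ hφ => ?_, fun 𝒦 _ _ h𝒦 c𝒦 c F hF φ hind => ?_⟩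
  · obtain ⟨F, hF, hind, -⟩ := metabelianLeafStar_cor39b_upToTwist_baseAt_source_of_finite 2 hℋ c cℋ φ hφ
    exact ⟨F, hF, hind⟩
  · exact metabelianLeafStar_cor39a_upToTwistAt_target_of_finite 2 h𝒦 c𝒦 c F hF φ hind

end ProfiniteSemiGraph

end Literature.AnabelianGeometry.SemiGraphs
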